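import Literature.NumberTheory.EllipticCurves.HeegnerPointsKolyvaginExceptionalSelmerProofs
import Literature.NumberTheory.EllipticCurves.HeegnerPointsKolyvaginPrimaryDescentProofs
import HarnessLib

/-!
# T1 JET (cell `bsd-jet`), road K, Ш-half of Jetchev Cor. 1.5 at `p ∣ N` — FRAME: Gross 1991 §10
# (`KolyvaginDescent.Hypotheses`) from per-prime local data over a RESTRICTED set of Kolyvagin
# primes, at an arbitrary level `n` killed by `p`, and the passage `Sel_n = ℤ·y ⟹ Ш(E/K)[p^∞] = 0`

HONEST FRAMING (programme file `BSD-LIT2PART-PROGRAMME-v1.md` §HONESTY, verbatim): «no tranche here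
proves BSD; ARM L moves the LITERAL column of an r ≤ 1 census into the kernel-proved-modulo-named-print
column; ARM P changes what «named print» is worth.» THEOREMS ONLY (seat `bsd-jet-pv-1`, session g9;
`--supports stmt-BirchSwinnertonDyer-14418`, helper); nothing is booked; 0 classes move.

WHY. Every JET row door (`JET.bsdp_of_jetRow*`, `JET.bsdp_of_carrier*Certificate_level*`) displays,
next to the reading binder `hJ` (road K: a kernel theorem modulo named print), the named fact
`McCallum1991_padicValNat_card_sha_primary_add_le_of_globalDivisibility` (`hMcU`, Kolyvagin–McCallum
Cor. 5.6: `ord_p #Ш(E/K)[p^∞] + 2t ≤ 2M₀` under global divisibility to depth `t`), and uses it ONLY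
with `M₀ ≤ w ≤ t`, i.e. in the extreme case `t = M₀` where the conclusion is `Ш(E/K)[p^∞] = 0`. That
case is Gross's §10 descent run on the DIVIDED Euler system `P_n ∕ p^{M₀}` at level `p`, with the
Kolyvagin primes restricted to `M(ℓ) ≥ M₀ + 1`. The tree proves §10 once, as pure algebra, for the
abstract data `KolyvaginDescent.Hypotheses` (`HeegnerPointsKolyvaginSelmerProofs`:
`Hypotheses.sel_eq_zmultiples`), and instantiates it for Gross's own system with `Kol` = ALL
Kolyvagin primes (`exists_hypotheses_of_localData`). THIS FILE is the same instantiation with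
(i) an ARBITRARY sub-predicate `Kol` of the Kolyvagin primes (every field of `Hypotheses` quantifies
over `Kol`, so restricting it is free), (ii) an arbitrary level `n` with `p · H¹(K, E[n]) = 0` (the
divided classes live in `H¹(K, E[p^1])`), (iii) an arbitrary generator `y ∈ Sel_n`, `y ≠ 0` (the
class of `P ∕ p^{M₀}`, not `δ y_K`). §2 is the passage to `Ш`: `Sel_n(E/K) ≤ ker(H¹(K, E[n]) →
H¹(K, E))` forces `Ш(E/K)[n] = 0` (Silverman X.4.2(a), tree `map_torsionH1ToH1_selmerGroup_holds`),
hence `Ш(E/K)[p^∞] = ⊥` when `p ∣ n`.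

What is proved (namespace `Summit.BirchSwinnertonDyer.Rank1Residual.JET.DividedDescent`):
* `exists_hypotheses_of_localData_of_kol` — the §10 data for `(V, Sel, y) = (H¹(K, E[n]), Sel_n, y)`
  from local data `h1` (classes: sign, Selmer off the conductor, Prop. 6.2 (2)), `h2` (Prop. 8.2),
  `h3` (Cor. 3.2, `τ`-eigenclasses) relative to `Kol`;
* `selmerGroup_eq_zmultiples_of_localData_of_kol` — `Sel_n(E/K) = ℤ · y` (Gross Prop. 2.3 shape);
* `sha_torsionBy_eq_zero_of_selmerGroup_le_ker`, `primaryComponent_sha_eq_bot_of_selmerGroup_le_ker`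
  — the passage to `Ш(E/K)[n] = 0` and `Ш(E/K)[p^∞] = ⊥`.
References: [cite: GrossLMS1991, Prop. 2.3, §10 (Claim 10.1, Prop. 10.2, Claim 10.3), Props. 5.4 (2),
6.2, 8.2] [cite: McCallumLMS1991, §3 Cor. 3.2, §5 Lemma 5.1, Cor. 5.6] [cite: SilvermanAEC2009,
Thm. X.4.2]. Design: no definitions; `K : Type u`. Axioms: `propext`, `Classical.choice`, `Quot.sound`.
-/

set_option autoImplicit false

noncomputable section

open scoped Classical

open WeierstrassCurve NumberField IsDedekindDomain Literature.NumberTheory.EllipticCurves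
  Literature.NumberTheory.EllipticCurves.KolyvaginDescent

universe u

namespace Summit.BirchSwinnertonDyer.Rank1Residual.JET.DividedDescent

/-! ### §1 Gross's §10 data over a restricted set of Kolyvagin primes, at a level killed by `p` -/

section LocalData

variable {N : ℕ} {W : WeierstrassCurve ℚ} {K : Type u} [Field K] [NumberField K]

/-- **The §10 data `KolyvaginDescent.Hypotheses` for `V = H¹(K, E[n])`, `Sel = Sel_n(E/K)`, an
arbitrary non-zero `y ∈ Sel`, over a SUB-PREDICATE `Kol` of Gross's Kolyvagin primes.** Exactly
`exists_hypotheses_of_localData` (`HeegnerPointsKolyvaginExceptionalSelmerProofs`) with: the level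
`p` replaced by any `n : ℤ` such that `p` kills `H¹(K, E[n])` (`hpn`); `Kol ℓ → IsKolyvaginPrime N W K p ℓ`
(`hKol`, giving the place `λ = (ℓ)` and its uniqueness); the classes `cl`, the sign `ε`, the local
data `h1`/`h2`/`h3` asked only at `Kol`-primes and square-free products of `Kol`-primes; `y := cl 1`
given abstractly with `y ∈ Sel`, `y ≠ 0`. Fields as in the template: `τ = conjAct W c n` (an
involution, `c² = 1`), `Loc` = `selmerLocalKer` at `HeightOneSpectrum (𝓞 K) ⊕ InfinitePlace K`,
`A ℓ = ⨅_{v ∋ ℓ} torsionLocalKer`. [cite: GrossLMS1991, §10 (setting), §4 (4.4), Props. 5.4 (2), 6.2,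
8.2] [cite: McCallumLMS1991, §3 Cor. 3.2] -/
theorem exists_hypotheses_of_localData_of_kol [W.IsElliptic] (hK : IsImaginaryQuadratic K)
    {p : ℕ} (hp : p.Prime) (hp2 : p ≠ 2) {n : ℤ}
    (hpn : ∀ x : galH1Torsion (W.baseChange K) n, (p : ℤ) • x = 0) (c : K ≃ₐ[ℚ] K)
    (Kol : ℕ → Prop) (hKol : ∀ ℓ, Kol ℓ → IsKolyvaginPrime N W K p ℓ)
    {y : galH1Torsion (W.baseChange K) n} (hy : y ∈ selmerGroup (W.baseChange K) n) (hy0 : y ≠ 0)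
    (h1 : ∃ (ε : ℤ) (cl : ℕ → galH1Torsion (W.baseChange K) n),
      (ε = 1 ∨ ε = -1) ∧ cl 1 = y ∧
      ∀ m : ℕ, Squarefree m → (∀ q ∈ m.primeFactors, Kol q) →
        conjAct W c n (cl m) = (ε * (-1) ^ m.primeFactors.card) • cl m ∧
        (∀ v : HeightOneSpectrum (𝓞 K), (m : 𝓞 K) ∉ v.asIdeal →
          cl m ∈ selmerLocalKer (W.baseChange K) (v.adicCompletion K) n) ∧
        (∀ w : InfinitePlace K, cl m ∈ selmerLocalKer (W.baseChange K) w.Completion n) ∧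
        (∀ ℓ : ℕ, ℓ.Prime → ℓ ∣ m → ∀ v : HeightOneSpectrum (𝓞 K), (ℓ : 𝓞 K) ∈ v.asIdeal →
          (cl m ∈ selmerLocalKer (W.baseChange K) (v.adicCompletion K) n ↔
            cl (m / ℓ) ∈ (W.baseChange K).torsionLocalKer (v.adicCompletion K) n)))
    (h2 : ∀ {ℓ : ℕ} (hℓ : IsKolyvaginPrime N W K p ℓ), Kol ℓ → ∀ (ν : ℤ) (_hν : ν = 1 ∨ ν = -1)
      (d : galH1Torsion (W.baseChange K) n) (_hd : conjAct W c n d = ν • d)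
      (_hfin : ∀ v : HeightOneSpectrum (𝓞 K), (ℓ : 𝓞 K) ∉ v.asIdeal →
        d ∈ selmerLocalKer (W.baseChange K) (v.adicCompletion K) n)
      (_hinf : ∀ w : InfinitePlace K, d ∈ selmerLocalKer (W.baseChange K) w.Completion n)
      (v : HeightOneSpectrum (𝓞 K)) (_hv : (ℓ : 𝓞 K) ∈ v.asIdeal)
      (_hdv : d ∉ selmerLocalKer (W.baseChange K) (v.adicCompletion K) n)
      (s : galH1Torsion (W.baseChange K) n) (_hs : s ∈ selmerGroup (W.baseChange K) n)
      (_hτs : conjAct W c n s = ν • s),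
      s ∈ (W.baseChange K).torsionLocalKer (v.adicCompletion K) n)
    (h3 : ∀ (r : ℕ) (cs : Fin r → galH1Torsion (W.baseChange K) n)
      (_hτ : ∀ i, ∃ e : ℤ, (e = 1 ∨ e = -1) ∧ conjAct W c n (cs i) = e • cs i)
      (Nv : Fin r → ℕ) (_hN : ∀ i, Nv i ≤ 1)
      (_hind : ∀ a : Fin r → ℤ, ∑ i, a i • cs i = 0 → ∀ i, (p : ℤ) ∣ a i) (b : ℕ),
      ∃ ℓ : ℕ, b < ℓ ∧ Kol ℓ ∧
        ∀ i, ∀ v : HeightOneSpectrum (𝓞 K), (ℓ : 𝓞 K) ∈ v.asIdeal →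
          (cs i ∈ (W.baseChange K).torsionLocalKer (v.adicCompletion K) n ↔ Nv i = 0)) :
    ∃ S : Hypotheses (galH1Torsion (W.baseChange K) n)
        (HeightOneSpectrum (𝓞 K) ⊕ InfinitePlace K),
      S.Sel = selmerGroup (W.baseChange K) n ∧ S.y = y ∧ S.p = p ∧ S.Kol = Kol := by
  have hcc : c * c = 1 := mul_self_eq_one_of_isImaginaryQuadratic hK c
  obtain ⟨ε, cl, hε, hc1, hcl⟩ := h1
  exact ⟨
    { p := p
      hp := hp
      hp2 := hp2
      torsion := hpn
      τ := conjAct W c n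
      τ_τ := conjAct_conjAct_of_mul_self W hcc n
      Sel := selmerGroup (W.baseChange K) n
      τ_mem := fun s hs ↦ conjAct_mem_selmerGroup W hK.2.isComplex c n hs
      Loc := Sum.elim (fun v ↦ selmerLocalKer (W.baseChange K) (v.adicCompletion K) n)
        (fun w ↦ selmerLocalKer (W.baseChange K) w.Completion n)
      mem_sel_iff := fun s ↦ by rw [mem_selmerGroup_iff, Sum.forall]; rfl
      Kol := Kol
      prime_of_kol := fun ℓ h ↦ (hKol ℓ h).prime
      pl := fun ℓ ↦ if h : Kol ℓ then Sum.inl (hKol ℓ h).place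
        else Sum.inr (Classical.arbitrary _)
      Dv := fun v m ↦ Sum.elim (fun v ↦ (m : 𝓞 K) ∈ v.asIdeal) (fun _ ↦ False) v
      dv_iff := fun ℓ hℓ v ↦ by
        rw [dif_pos hℓ]
        rcases v with v | w
        · simp only [Sum.elim_inl, Sum.inl.injEq]
          exact (hKol ℓ hℓ).mem_iff
        · simp
      dv_mul := fun ℓ ℓ' _ _ v ↦ by
        rcases v with v | w
        · exact natCast_mul_mem_asIdeal
        · simp
      A := fun ℓ ↦ ⨅ (v : HeightOneSpectrum (𝓞 K)) (_ : (ℓ : 𝓞 K) ∈ v.asIdeal),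
        (W.baseChange K).torsionLocalKer (v.adicCompletion K) n
      y := y
      y_mem := hy
      y_ne := hy0
      ε := ε
      hε := hε
      c := cl
      c_one := hc1
      τ_c := fun m hm ↦ (hcl m hm.1 hm.2).1
      c_mem_loc := fun m hm v hv ↦ by
        rcases v with v | w
        · exact (hcl m hm.1 hm.2).2.1 v hv
        · exact (hcl m hm.1 hm.2).2.2.1 w
      c_mem_loc_iff := fun ℓ m hℓ hm ↦ by
        rw [dif_pos hℓ]
        simp only [Sum.elim_inl, AddSubgroup.mem_iInf]
        have key := (hcl (ℓ * m) hm.1 hm.2).2.2.2 ℓ (hKol ℓ hℓ).prime (dvd_mul_right ℓ m)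
          (hKol ℓ hℓ).place (hKol ℓ hℓ).mem_place
        rw [Nat.mul_div_cancel_left m (hKol ℓ hℓ).prime.pos] at key
        rw [key]
        constructor
        · intro h v hv
          rwa [(hKol ℓ hℓ).mem_iff.mp hv]
        · intro h
          exact h (hKol ℓ hℓ).place (hKol ℓ hℓ).mem_place
      prop82 := fun ℓ hℓ ν hν d hd hoff hat s hs hτs ↦ by
        rw [dif_pos hℓ] at hoff hat
        simp only [AddSubgroup.mem_iInf]
        intro v hv
        refine h2 (hKol ℓ hℓ) hℓ ν hν d hd (fun v' hv' ↦ ?_) (fun w ↦ ?_) v hv ?_ s hs hτs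
        · exact hoff (Sum.inl v')
            (fun h ↦ hv' ((hKol ℓ hℓ).mem_iff.mpr (Sum.inl_injective h)))
        · exact hoff (Sum.inr w) (by simp)
        · rwa [(hKol ℓ hℓ).mem_iff.mp hv]
      cebotarev := fun r cs Nv hN hτ hind b ↦ by
        obtain ⟨ℓ, hlt, hℓ, hloc⟩ := h3 r cs hτ Nv hN hind b
        refine ⟨ℓ, hlt, hℓ, fun i ↦ ?_⟩
        simp only [AddSubgroup.mem_iInf]
        constructor
        · intro h
          exact (hloc i (hKol ℓ hℓ).place (hKol ℓ hℓ).mem_place).mp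
            (h (hKol ℓ hℓ).place (hKol ℓ hℓ).mem_place)
        · intro h v hv
          exact (hloc i v hv).mpr h }, rfl, rfl, rfl, rfl⟩

/-- **`Sel_n(E/K) = ℤ · y` (Gross 1991 Prop. 2.3 shape) from the restricted local data** — Gross's
§10 (`KolyvaginDescent.Hypotheses.sel_eq_zmultiples`, pure algebra, PROVED in the tree) for the data
of `exists_hypotheses_of_localData_of_kol`. [cite: GrossLMS1991, Prop. 2.3 (proof: §10)] -/
theorem selmerGroup_eq_zmultiples_of_localData_of_kol [W.IsElliptic] (hK : IsImaginaryQuadratic K)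
    {p : ℕ} (hp : p.Prime) (hp2 : p ≠ 2) {n : ℤ}
    (hpn : ∀ x : galH1Torsion (W.baseChange K) n, (p : ℤ) • x = 0) (c : K ≃ₐ[ℚ] K)
    (Kol : ℕ → Prop) (hKol : ∀ ℓ, Kol ℓ → IsKolyvaginPrime N W K p ℓ)
    {y : galH1Torsion (W.baseChange K) n} (hy : y ∈ selmerGroup (W.baseChange K) n) (hy0 : y ≠ 0)
    (h1 : ∃ (ε : ℤ) (cl : ℕ → galH1Torsion (W.baseChange K) n),
      (ε = 1 ∨ ε = -1) ∧ cl 1 = y ∧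
      ∀ m : ℕ, Squarefree m → (∀ q ∈ m.primeFactors, Kol q) →
        conjAct W c n (cl m) = (ε * (-1) ^ m.primeFactors.card) • cl m ∧
        (∀ v : HeightOneSpectrum (𝓞 K), (m : 𝓞 K) ∉ v.asIdeal →
          cl m ∈ selmerLocalKer (W.baseChange K) (v.adicCompletion K) n) ∧
        (∀ w : InfinitePlace K, cl m ∈ selmerLocalKer (W.baseChange K) w.Completion n) ∧
        (∀ ℓ : ℕ, ℓ.Prime → ℓ ∣ m → ∀ v : HeightOneSpectrum (𝓞 K), (ℓ : 𝓞 K) ∈ v.asIdeal →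
          (cl m ∈ selmerLocalKer (W.baseChange K) (v.adicCompletion K) n ↔
            cl (m / ℓ) ∈ (W.baseChange K).torsionLocalKer (v.adicCompletion K) n)))
    (h2 : ∀ {ℓ : ℕ} (hℓ : IsKolyvaginPrime N W K p ℓ), Kol ℓ → ∀ (ν : ℤ) (_hν : ν = 1 ∨ ν = -1)
      (d : galH1Torsion (W.baseChange K) n) (_hd : conjAct W c n d = ν • d)
      (_hfin : ∀ v : HeightOneSpectrum (𝓞 K), (ℓ : 𝓞 K) ∉ v.asIdeal →
        d ∈ selmerLocalKer (W.baseChange K) (v.adicCompletion K) n)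
      (_hinf : ∀ w : InfinitePlace K, d ∈ selmerLocalKer (W.baseChange K) w.Completion n)
      (v : HeightOneSpectrum (𝓞 K)) (_hv : (ℓ : 𝓞 K) ∈ v.asIdeal)
      (_hdv : d ∉ selmerLocalKer (W.baseChange K) (v.adicCompletion K) n)
      (s : galH1Torsion (W.baseChange K) n) (_hs : s ∈ selmerGroup (W.baseChange K) n)
      (_hτs : conjAct W c n s = ν • s),
      s ∈ (W.baseChange K).torsionLocalKer (v.adicCompletion K) n)
    (h3 : ∀ (r : ℕ) (cs : Fin r → galH1Torsion (W.baseChange K) n)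
      (_hτ : ∀ i, ∃ e : ℤ, (e = 1 ∨ e = -1) ∧ conjAct W c n (cs i) = e • cs i)
      (Nv : Fin r → ℕ) (_hN : ∀ i, Nv i ≤ 1)
      (_hind : ∀ a : Fin r → ℤ, ∑ i, a i • cs i = 0 → ∀ i, (p : ℤ) ∣ a i) (b : ℕ),
      ∃ ℓ : ℕ, b < ℓ ∧ Kol ℓ ∧
        ∀ i, ∀ v : HeightOneSpectrum (𝓞 K), (ℓ : 𝓞 K) ∈ v.asIdeal →
          (cs i ∈ (W.baseChange K).torsionLocalKer (v.adicCompletion K) n ↔ Nv i = 0)) :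
    selmerGroup (W.baseChange K) n = AddSubgroup.zmultiples y := by
  obtain ⟨S, hS, hSy, -, -⟩ :=
    exists_hypotheses_of_localData_of_kol hK hp hp2 hpn c Kol hKol hy hy0 h1 h2 h3
  rw [← hS, ← hSy]
  exact S.sel_eq_zmultiples

end LocalData

/-! ### §2 From `Sel_n(E/K) ≤ ker(H¹(K, E[n]) → H¹(K, E))` to `Ш(E/K)[n] = 0` and `Ш(E/K)[p^∞] = ⊥` -/

section Sha

variable {F : Type u} [Field F] [NumberField F] (E : WeierstrassCurve F)

/-- **`Ш(E/K)[n] = 0` when the `n`-Selmer group consists of Kummer classes**: if every class of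
`Sel_n(E/K) ⊆ H¹(K, E[n])` dies in `H¹(K, E)` then every `c ∈ Ш(E/K)` with `n c = 0` is `0` — the
exactness of `0 → E(K)/n → Sel_n → Ш[n] → 0` (Silverman X.4.2(a), tree
`map_torsionH1ToH1_selmerGroup_holds`). [cite: SilvermanAEC2009, Thm. X.4.2 (a)]
[cite: GrossLMS1991, §2 (2.2)–(2.3)] -/
theorem sha_torsionBy_eq_zero_of_selmerGroup_le_ker {n : ℤ} (hn : n ≠ 0)
    (hsel : selmerGroup E n ≤ (torsionH1ToH1 E n).ker)
    (c : E.sha) (hc : n • c = 0) : c = 0 := by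
  have hc' : (c : E.galH1) ∈ E.sha ⊓ AddSubgroup.torsionBy E.galH1 n := by
    refine AddSubgroup.mem_inf.mpr ⟨c.2, ?_⟩
    rw [mem_torsionBy_iff, ← AddSubgroupClass.coe_zsmul, hc, ZeroMemClass.coe_zero]
  rw [← E.map_torsionH1ToH1_selmerGroup_holds hn, AddSubgroup.mem_map] at hc'
  obtain ⟨s, hs, hts⟩ := hc'
  have h0 : torsionH1ToH1 E n s = 0 := (AddMonoidHom.mem_ker).mp (hsel hs)
  apply Subtype.ext
  rw [ZeroMemClass.coe_zero, ← hts, h0]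

/-- **`Ш(E/K)[p^∞] = ⊥` when `Sel_n(E/K)` consists of Kummer classes for some `n` with `p ∣ n`**:
an element of the `p`-primary component is killed by some `p^k`; if `k ≥ 1` then `p^{k-1} c` is
killed by `p ∣ n`, hence by `n`, hence is `0` by `sha_torsionBy_eq_zero_of_selmerGroup_le_ker`;
induct (`p` any natural number dividing `n`). [cite: SilvermanAEC2009, Thm. X.4.2 (a)] [cite: GrossLMS1991, Prop. 2.3, Thm. 1.3 (2)] -/
theorem primaryComponent_sha_eq_bot_of_selmerGroup_le_ker {p : ℕ} {n : ℤ}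
    (hn : n ≠ 0) (hpn : (p : ℤ) ∣ n)
    (hsel : selmerGroup E n ≤ (torsionH1ToH1 E n).ker) :
    AddCommGroup.primaryComponent E.sha p = ⊥ := by
  -- no `p`-torsion in `Ш(E/K)`
  have hnop : ∀ c : E.sha, (p : ℤ) • c = 0 → c = 0 := by
    intro c hc
    obtain ⟨m, hm⟩ := hpn
    refine sha_torsionBy_eq_zero_of_selmerGroup_le_ker E hn hsel c ?_
    rw [hm, mul_comm, mul_smul, hc, smul_zero]
  have hpow : ∀ (k : ℕ) (c : E.sha), p ^ k • c = 0 → c = 0 := by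
    intro k
    induction k with
    | zero => intro c h; simpa using h
    | succ k ih =>
      intro c h
      refine ih c (hnop _ ?_)
      rw [natCast_zsmul, ← mul_nsmul', ← pow_succ']
      exact h
  rw [eq_bot_iff]
  intro c hc
  rw [AddCommGroup.mem_primaryComponent] at hc
  obtain ⟨k, hk⟩ := hc
  rw [AddSubgroup.mem_bot]
  exact hpow k c hk

/-- **`Sel_n(E/K) = ℤ · y` with `y` a Kummer class ⟹ `Ш(E/K)[p^∞] = ⊥`** (`p ∣ n ≠ 0`): the form in
which §1 is consumed. [cite: GrossLMS1991, Prop. 2.3, Thm. 1.3 (2)] [cite: SilvermanAEC2009, Thm. X.4.2 (a)] -/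
theorem primaryComponent_sha_eq_bot_of_selmerGroup_eq_zmultiples {p : ℕ} {n : ℤ}
    (hn : n ≠ 0) (hpn : (p : ℤ) ∣ n) {y : galH1Torsion E n} (hy : torsionH1ToH1 E n y = 0)
    (hsel : selmerGroup E n = AddSubgroup.zmultiples y) :
    AddCommGroup.primaryComponent E.sha p = ⊥ := by
  refine primaryComponent_sha_eq_bot_of_selmerGroup_le_ker E hn hpn ?_
  rw [hsel]
  exact AddSubgroup.zmultiples_le_of_mem ((AddMonoidHom.mem_ker).mpr hy)

end Sha

end Summit.BirchSwinnertonDyer.Rank1Residual.JET.DividedDescent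

end
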